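import Mathlib
import Summits.Ventures.PercRepro2.HubKernelP1Cert

/-!
# The kernel check of the hub certificates for p1's kernel `K₃`, first index `3`
(blind cell PercRepro2, typer-1 g8; the typed R theorem, part T2)

`hub_checkK3_3`: for the 25 atom triples `(3, b, d)` the doubled symmetrised Kronecker hub number
of `K₃` equals the Kronecker number of the symmetrised certificates — one `decide +kernel`.
-/

namespace Summit.Ventures.PercRepro2.Hub

set_option maxHeartbeats 0 in
set_option maxRecDepth 100000 in
/-- **The kernel check for `K₃`, first index `3`.** -/
theorem hub_checkK3_3 : ∀ b d : Fin 5, 2 * kronSymK3 3 b d = certNum 3 b d := by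
  decide +kernel

end Summit.Ventures.PercRepro2.Hub
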